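import Summits.BirchSwinnertonDyer.BirchSwinnertonDyer.Theorems.ResidualThetaTransportAtTwoThetaLayerLambdaCongruenceAtTwoCuspSpanAuxPrime
import Mathlib.NumberTheory.LSeries.PrimesInAP
import Mathlib.NumberTheory.LegendreSymbol.QuadraticReciprocity
import Mathlib.Data.Nat.Factorization.Basic
import HarnessLib

/-!
# Route `ResidualThetaTransportAtTwo`, node 27436 (cruxes Kan⁺ stmt-BirchSwinnertonDyer-20688 / 21437): the AUXILIARY PRIME of the
# `q`-adic triangles at PRIME-POWER level `p^E` (Dirichlet + quadratic reciprocity)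

Cell `bsd-wall`, width seat `bsd-wall-rtt-p3-w2` g4 (2026-08-28). THEOREMS ONLY (pure arithmetic, no `χ`);
`--supports stmt-BirchSwinnertonDyer-20688`; BSD is not proved by this.

MAIN (`exists_aux_prime_pow`). Sequel to `…CuspSpanAuxPrime` (the case `E = 1`). For odd primes `p ≠ q`, `E, e ≥ 1` and a class `a`
mod `p^E` with `a ≢ 0, 1 (mod p)` there is a prime `n > max(p, q)` with `n ≡ a (mod p^E)`, `q^e ∣ n + 1`, `n ≡ 3 (mod 4)`,
`gcd((n−1)/2, p^{E−1}(p−1)) = 1` and `q^{(n−1)/2} ≡ 1 (mod n)`. Same construction (`n ≡ a (p^E)`, `≡ −1 (q^e)`, `≡ 3 (4)`, `≡ 2 (M)`,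
`M` the part of `p − 1` prime to `2q`); `p ∤ (n−1)/2` is the new requirement `a ≢ 1 (mod p)`; reciprocity as before
(`pow_half_eq_one_of_dvd_succ`). Consumed by `…CuspSpanRuleQPrimePow`: `t` with `(n−1)/2 ∣ t`, `t ≡ 1 (mod φ(p^E))`.

References: P. G. L. Dirichlet (1837) / Mathlib `PrimesInAP`; C. F. Gauss, *Disquisitiones* §4 (reciprocity) / Mathlib
`legendreSym.quadratic_reciprocity`; [Pollack2003] Conj. 6.3 (the node these files serve).
-/

set_option autoImplicit false
set_option linter.dupNamespace false

namespace Summit.BirchSwinnertonDyer.BirchSwinnertonDyer.Theorems.SignedMuAtTwo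

/-- **The auxiliary prime at prime-power level.** For odd primes `p ≠ q`, `E, e ≥ 1` and `a` with `a ≢ 0, 1 (mod p)`: a prime
`n > max(p, q)` with `n ≡ a (mod p^E)`, `q^e ∣ n + 1`, `n ≡ 3 (mod 4)`, `gcd((n−1)/2, p^{E−1}(p−1)) = 1`, `q^{(n−1)/2} ≡ 1 (mod n)`.
[folklore] -/
theorem exists_aux_prime_pow (p q : ℕ) (hp : p.Prime) (hq : q.Prime) (hp2 : p ≠ 2) (hq2 : q ≠ 2) (hpq : p ≠ q)
    {E : ℕ} (hE : 1 ≤ E) {e : ℕ} (he : 1 ≤ e) (a : ℕ) (ha : ¬ p ∣ a) (ha1 : a % p ≠ 1) :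
    ∃ n : ℕ, n.Prime ∧ p < n ∧ q < n ∧ n ≡ a [MOD p ^ E] ∧ q ^ e ∣ n + 1 ∧ n % 4 = 3 ∧
      Nat.Coprime (n / 2) (p ^ (E - 1) * (p - 1)) ∧ (q : ZMod n) ^ (n / 2) = 1 := by
  have hp3 : 3 ≤ p := by
    have := hp.two_le; rcases Nat.lt_or_ge 2 p with h | h
    · omega
    · exfalso; exact hp2 (le_antisymm h hp.two_le)
  have hq3 : 3 ≤ q := by
    have := hq.two_le; rcases Nat.lt_or_ge 2 q with h | h
    · omega
    · exfalso; exact hq2 (le_antisymm h hq.two_le)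
  have hp1 : p - 1 ≠ 0 := by omega
  -- the modulus `M` (the part of `p − 1` prime to `2q`)
  set O : ℕ := ordCompl[2] (p - 1) with hOdef
  set M : ℕ := ordCompl[q] O with hMdef
  have hO0 : O ≠ 0 := (Nat.ordCompl_pos 2 hp1).ne'
  have hM0 : M ≠ 0 := (Nat.ordCompl_pos q hO0).ne'
  have h2O : ¬ 2 ∣ O := Nat.not_dvd_ordCompl Nat.prime_two hp1
  have hMO : M ∣ O := Nat.ordCompl_dvd O q
  have h2M : ¬ 2 ∣ M := fun h ↦ h2O (h.trans hMO)
  have hqM : ¬ q ∣ M := Nat.not_dvd_ordCompl hq hO0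
  have hMp : M ∣ p - 1 := hMO.trans (Nat.ordCompl_dvd (p - 1) 2)
  have hpM : ¬ p ∣ M := fun h ↦ by
    have := Nat.le_of_dvd (Nat.pos_of_ne_zero hM0) h
    have := Nat.le_of_dvd (by omega) hMp
    omega
  -- pairwise coprimality of the moduli `p^E`, `q^e`, `4`, `M`
  have cpq : Nat.Coprime (p ^ E) (q ^ e) :=
    (Nat.Coprime.pow_right _ ((Nat.coprime_primes hp hq).mpr hpq)).pow_left _
  have cp4 : Nat.Coprime (p ^ E) 4 := by
    have : Nat.Coprime p 2 := (Nat.coprime_primes hp Nat.prime_two).mpr hp2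
    simpa using (this.pow_right 2).pow_left E
  have cq4 : Nat.Coprime (q ^ e) 4 := by
    have : Nat.Coprime q 2 := (Nat.coprime_primes hq Nat.prime_two).mpr hq2
    simpa using (this.pow_right 2).pow_left e
  have cpM : Nat.Coprime (p ^ E) M := ((Nat.Prime.coprime_iff_not_dvd hp).mpr hpM).pow_left E
  have cqM : Nat.Coprime (q ^ e) M := ((Nat.Prime.coprime_iff_not_dvd hq).mpr hqM).pow_left e
  have c4M : Nat.Coprime 4 M := by
    have : Nat.Coprime 2 M := (Nat.Prime.coprime_iff_not_dvd Nat.prime_two).mpr h2M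
    simpa using this.pow_left 2
  have c1 : Nat.Coprime (p ^ E * q ^ e) 4 := Nat.Coprime.mul_left cp4 cq4
  have c2 : Nat.Coprime (p ^ E * q ^ e * 4) M := Nat.Coprime.mul_left (Nat.Coprime.mul_left cpM cqM) c4M
  -- CRT
  obtain ⟨r₁, hr₁p, hr₁q⟩ := Nat.chineseRemainder cpq a (q ^ e - 1)
  obtain ⟨r₂, hr₂pq, hr₂4⟩ := Nat.chineseRemainder c1 r₁ 3
  obtain ⟨r₃, hr₃pq4, hr₃M⟩ := Nat.chineseRemainder c2 r₂ 2
  have e2 : r₃ ≡ r₁ [MOD p ^ E * q ^ e] := (hr₃pq4.of_mul_right 4).trans hr₂pq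
  have h3p : r₃ ≡ a [MOD p ^ E] := (e2.of_mul_right (q ^ e)).trans hr₁p
  have h3p1 : r₃ ≡ a [MOD p] := h3p.of_dvd (dvd_pow_self p (by omega))
  have h3q : r₃ ≡ q ^ e - 1 [MOD q ^ e] := (e2.of_mul_left (p ^ E)).trans hr₁q
  have h34 : r₃ ≡ 3 [MOD 4] := (hr₃pq4.of_mul_left (p ^ E * q ^ e)).trans hr₂4
  -- `r₃` is prime to the modulus
  have hqe1 : 1 ≤ q ^ e := Nat.one_le_pow _ _ hq.pos
  have cr_p : Nat.Coprime r₃ (p ^ E) := by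
    apply Nat.Coprime.pow_right
    rw [Nat.coprime_comm, Nat.Prime.coprime_iff_not_dvd hp]
    intro h
    exact ha ((Nat.modEq_zero_iff_dvd.mp (h3p1.symm.trans (Nat.modEq_zero_iff_dvd.mpr h))))
  have cr_q : Nat.Coprime r₃ (q ^ e) := by
    apply Nat.Coprime.pow_right
    rw [Nat.coprime_comm, Nat.Prime.coprime_iff_not_dvd hq]
    intro h
    have h1 : q ^ e ∣ r₃ + 1 := by
      have e1 : r₃ + 1 ≡ q ^ e - 1 + 1 [MOD q ^ e] := h3q.add_right 1
      rw [Nat.sub_add_cancel hqe1] at e1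
      exact Nat.modEq_zero_iff_dvd.mp (e1.trans (Nat.modEq_zero_iff_dvd.mpr dvd_rfl))
    have h2 : q ∣ r₃ + 1 := (dvd_pow_self q (by omega)).trans h1
    have : q ∣ 1 := (Nat.dvd_add_right h).mp h2
    exact hq.one_lt.ne' (Nat.dvd_one.mp this)
  have cr_4 : Nat.Coprime r₃ 4 := by
    have hodd : r₃ % 2 = 1 := by have := h34; unfold Nat.ModEq at this; omega
    have : Nat.Coprime r₃ 2 := Nat.coprime_two_right.mpr (Nat.odd_iff.mpr hodd)
    simpa using this.pow_right 2
  have cr_M : Nat.Coprime r₃ M := by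
    have h1 : Nat.gcd r₃ M = Nat.gcd 2 M := hr₃M.gcd_eq
    rw [Nat.Coprime, h1]
    exact (Nat.Prime.coprime_iff_not_dvd Nat.prime_two).mpr h2M
  have hcop : Nat.Coprime r₃ (p ^ E * q ^ e * 4 * M) :=
    Nat.Coprime.mul_right (Nat.Coprime.mul_right (Nat.Coprime.mul_right cr_p cr_q) cr_4) cr_M
  have hQ0 : p ^ E * q ^ e * 4 * M ≠ 0 := by positivity
  -- Dirichlet
  obtain ⟨n, hngt, hnprime, hnmod⟩ := Nat.forall_exists_prime_gt_and_modEq (max p q) (q := p ^ E * q ^ e * 4 * M)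
    (a := r₃) hQ0 hcop
  have hnp : n ≡ a [MOD p ^ E] := (((hnmod.of_mul_right M).of_mul_right 4).of_mul_right (q ^ e)).trans h3p
  have hnp1 : n ≡ a [MOD p] := hnp.of_dvd (dvd_pow_self p (by omega))
  have hnq : n ≡ q ^ e - 1 [MOD q ^ e] := (((hnmod.of_mul_right M).of_mul_right 4).of_mul_left (p ^ E)).trans h3q
  have hn4 : n % 4 = 3 := by
    have := (hnmod.of_mul_right M).of_mul_left (p ^ E * q ^ e) |>.trans h34
    unfold Nat.ModEq at this; simpa using this
  have hnM : n ≡ 2 [MOD M] := (hnmod.of_mul_left (p ^ E * q ^ e * 4)).trans hr₃M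
  have hpn : p < n := lt_of_le_of_lt (le_max_left _ _) hngt
  have hqn : q < n := lt_of_le_of_lt (le_max_right _ _) hngt
  have hqdvd : q ^ e ∣ n + 1 := by
    have e1 : n + 1 ≡ q ^ e - 1 + 1 [MOD q ^ e] := hnq.add_right 1
    rw [Nat.sub_add_cancel hqe1] at e1
    exact Nat.modEq_zero_iff_dvd.mp (e1.trans (Nat.modEq_zero_iff_dvd.mpr dvd_rfl))
  have hqdvd1 : q ∣ n + 1 := (dvd_pow_self q (by omega)).trans hqdvd
  -- `gcd((n−1)/2, p^{E−1}(p−1)) = 1`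
  have hcopr : Nat.Coprime (n / 2) (p ^ (E - 1) * (p - 1)) := by
    apply Nat.coprime_of_dvd
    intro r hr hrn hrp'
    have hrn1 : r ∣ n - 1 := by
      have : n - 1 = 2 * (n / 2) := by omega
      rw [this]; exact hrn.mul_left 2
    -- `r = p` is excluded by `a ≢ 1 (mod p)`
    have hrp : r ∣ p - 1 := by
      rcases (Nat.Prime.dvd_mul hr).mp hrp' with h | h
      · exfalso
        have hrp0 : r = p := (Nat.prime_dvd_prime_iff_eq hr hp).mp (hr.dvd_of_dvd_pow h)
        rw [hrp0] at hrn1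
        obtain ⟨kk, hkk⟩ := hrn1
        have hn1 : n % p = 1 := by
          have : n = 1 + p * kk := by omega
          rw [this, Nat.add_mul_mod_self_left]
          exact Nat.mod_eq_of_lt hp.one_lt
        unfold Nat.ModEq at hnp1
        rw [hn1] at hnp1
        exact ha1 hnp1.symm
      · exact h
    by_cases hr2 : r = 2
    · subst hr2
      have : (n / 2) % 2 = 1 := by omega
      omega
    by_cases hrq : r = q
    · subst hrq
      have h2 : r ∣ (n + 1) - (n - 1) := Nat.dvd_sub hqdvd1 hrn1
      have : (n + 1) - (n - 1) = 2 := by omega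
      rw [this] at h2
      have := Nat.le_of_dvd (by norm_num) h2
      omega
    · have hrM : r ∣ M := dvd_ordCompl_ordCompl hp1 hq hr hr2 hrq hrp
      have hn2r : n ≡ 2 [MOD r] := hnM.of_dvd hrM
      have hrn2 : r ∣ n - 2 := (Nat.modEq_iff_dvd' (by omega : 2 ≤ n)).mp hn2r.symm
      have h2 : r ∣ (n - 1) - (n - 2) := Nat.dvd_sub hrn1 hrn2
      rw [show (n - 1) - (n - 2) = 1 by omega] at h2
      exact hr.one_lt.ne' (Nat.dvd_one.mp h2)
  exact ⟨n, hnprime, hpn, hqn, hnp, hqdvd, hn4, hcopr, pow_half_eq_one_of_dvd_succ q n hq hnprime hq2 hn4 hqdvd1⟩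

end Summit.BirchSwinnertonDyer.BirchSwinnertonDyer.Theorems.SignedMuAtTwo
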